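import Summits.CriticalPhenomena.PercolationContinuityZ3.Theorems.Transplant.SkelFrmBChoiceWindow
import HarnessLib

/-!
# N2 (frames-only node `SamePDropOfSkeletonFrm₁`, OPEN) — (ζ″) ledger: THE SECOND-AXIS ALONG RESIDUAL, RETUNED — `NegB.qxYQ2 := (8·sL).toNat + 20`
# (stmt-g21 located item 2026-08-23T09:16:50Z, cure (2a): one `sL` less start window along the y′-run ⇒ two along-parking strides fewer ⇒ the y-arrival's
# across (fine-0) half-spread drops by ≈ 2·s₀, restoring a margin in `HY`'s `hLt` row at the window of record `b₀ = 30·s₀`)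

`SkelFrmBChoiceWindow` (p355412) fixed `qxYQ := (9·sL).toNat + 19`, i.e. `kgqY qxYQ = P + 9·sL + 19`, one `sL` above what the start-box row `hbq : bLS small ≤ qq` needs
(`bLS small ≤ 9·sL + 20`, `bLS_le` at `e = 9`, and `P ≥ sL + 1`).  The y′-corridor's along-parking length `m₂Y + 1 ≈ (2q + …)/sL` and hence the y-arrival's across
half-width `(m₂Y+1)·(R′+ρ+|v|)` grow with `q`; at `b₀ = 30·s₀` the `hLt` window has no slack to spare (stmt-g21's sizing, HOME/prim-bschramm-stmt-g21/
LOCATED-ystep-xcreep.md).  This file files the MINIMAL residual **`qxYQ2 := (8·sL).toNat + 20`** (`kgqY qxYQ2 = P + 8·sL + 20 ≥ 9·sL + 20 ≥ bLS small` by `sL ≤ P − 1`),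
with `kgResY_Q2 : KGResY … qxYQ2 WxYQ` and `hbq_small2`; `WxYQ`, `haW_small` unchanged.  The landed `qxYQ` stays a valid (unused) value.
* `kgSL_le_natDiv` (`sL ≤ ⌊nℓ/U⌋`), `qxYQ2`, `kgqY_qxYQ2` (value), `kgResY_Q2`, `hbq_small2`.
NON-VACUITY: value rows at the closed tuple (binder set = `hbq_small`'s).
builds on p205010 (kernel theorem, internal audit signed; external expert review pending) — nothing in this file uses p205010; NOTHING is claimed about the open
node `SamePDropOfSkeletonFrm₁`.
Lane `prim-bschramm`, seat `prim-bschramm-stmt` (gen 21); helper file (`--supports stmt-CriticalPhenomena-4575 --as helper`).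
[cite: KozmaNitzan2024, §4 Lemma 12 (pp. 23–25: the start box)] [cite: MartineauTassion2017, §4.3 Lemma 4.2 (steering)]
-/

open scoped Classical

noncomputable section

namespace Summit.CriticalPhenomena.PercolationContinuityZ3.Theorems.Transplant

namespace PlanarSkeletonFrm

namespace NegB

open Literature.Probability.Percolation Literature.Probability.LatticeModels SimpleGraph
open SkelConc (Consts)
open Skelφ (shearUnit kgSL)
open Neg

section Y2

variable (κ : Consts) {V : Type} [DecidableEq V] [Countable V] {G : SimpleGraph V} [G.LocallyFinite] (Φ : PlanarSkeletonFrm G) (t : V) (p : unitInterval)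
  (D : Skelφ.StepI.DataNS V) (g f : ℕ)

/-- `sL ≤ ⌊nℓ/U⌋` (`sL = ⌊(nℓ − U + 1)/U⌋`). [folklore] -/
theorem kgSL_le_natDiv (hN : EqNumL κ Φ t p D g f) :
    kgSL (nL κ Φ t p D g f) (ℓL κ Φ t p D g f) (hL κ Φ t p D g f) ≤
      ((nL κ Φ t p D g f * ℓL κ Φ t p D g f / shearUnit (nL κ Φ t p D g f) (hL κ Φ t p D g f) : ℕ) : ℤ) := by
  obtain ⟨hn1, -⟩ := one_le_of_eqNumL κ Φ t p D g f hN
  have hU : (0 : ℤ) < (shearUnit (nL κ Φ t p D g f) (hL κ Φ t p D g f) : ℕ) := Skelφ.shearUnit_pos hn1 _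
  have hdiv : ((nL κ Φ t p D g f * ℓL κ Φ t p D g f / shearUnit (nL κ Φ t p D g f) (hL κ Φ t p D g f) : ℕ) : ℤ) =
      (nL κ Φ t p D g f : ℤ) * ℓL κ Φ t p D g f / (shearUnit (nL κ Φ t p D g f) (hL κ Φ t p D g f) : ℕ) := by push_cast; rfl
  rw [hdiv]; unfold kgSL
  exact Int.ediv_le_ediv hU (by linarith)

/-- **The retuned second-axis along residual** `qxYQ2 := (8·sL).toNat + 20`. [this work] -/
def qxYQ2 : ℕ := (8 * kgSL (nL κ Φ t p D g f) (ℓL κ Φ t p D g f) (hL κ Φ t p D g f)).toNat + 20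

/-- `kgqY qxYQ2 = P + 8·sL + 20` as an integer (`P = ⌊nℓ/U⌋ + 1`). [folklore] -/
theorem kgqY_qxYQ2 (hN : EqNumL κ Φ t p D g f) :
    ((kgqY κ Φ t p D g f (qxYQ2 κ Φ t p D g f) : ℕ) : ℤ) =
      ((nL κ Φ t p D g f * ℓL κ Φ t p D g f / shearUnit (nL κ Φ t p D g f) (hL κ Φ t p D g f) : ℕ) : ℤ) + 1 +
        8 * kgSL (nL κ Φ t p D g f) (ℓL κ Φ t p D g f) (hL κ Φ t p D g f) + 20 := by
  have hsL := ML_sub_one_le_kgSL κ Φ t p D g f hN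
  have h960 := slack_floor_le_ML κ Φ t p D g
  have hM : (959 : ℤ) ≤ ML κ Φ t p D g := by exact_mod_cast (show 959 ≤ ML κ Φ t p D g by omega)
  unfold kgqY qxYQ2
  push_cast
  rw [Int.toNat_of_nonneg (by linarith)]
  ring

/-- **`KGResY … qxYQ2 WxYQ`** (`8sL + 20 ≤ 40·sL`, `WxYQ ≤ 40·n_L`). [this work] -/
theorem kgResY_Q2 (hN : EqNumL κ Φ t p D g f) : KGResY κ Φ t p D g f (qxYQ2 κ Φ t p D g f) (WxYQ κ Φ t p D g f) := by
  refine ⟨?_, (kgResY_Q κ Φ t p D g f hN).hWx⟩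
  have hsL := ML_sub_one_le_kgSL κ Φ t p D g f hN
  have h960 := slack_floor_le_ML κ Φ t p D g
  have hM : (959 : ℤ) ≤ ML κ Φ t p D g := by exact_mod_cast (show 959 ≤ ML κ Φ t p D g by omega)
  unfold qxYQ2
  rw [kgSLY_eq_kgSL]
  push_cast
  rw [Int.toNat_of_nonneg (by linarith)]
  linarith

/-- **`hbq`** at the window of record and the retuned residual: `bLS small ≤ kgqY qxYQ2 = P + 8·sL + 20` (`bLS small ≤ 9sL + 20`, `sL ≤ P − 1`). [this work] -/
theorem hbq_small2 (hN : EqNumL κ Φ t p D g f) :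
    bLS κ Φ t p D g f (BSlot.small κ Φ t p D g f) ≤ ((kgqY κ Φ t p D g f (qxYQ2 κ Φ t p D g f) : ℕ) : ℤ) := by
  have h := bLS_le κ Φ t p D g f _ (by norm_num) hN (small_row_across κ Φ t p D g f)
  have hP := kgSL_le_natDiv κ Φ t p D g f hN
  rw [kgqY_qxYQ2 κ Φ t p D g f hN]
  linarith

end Y2

end NegB

end PlanarSkeletonFrm

end Summit.CriticalPhenomena.PercolationContinuityZ3.Theorems.Transplant

end
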